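import Summits.Parity.GeneralizedHardyLittlewood.Theses.LiouvilleMAD
import Summits.Parity.GeneralizedHardyLittlewood.Theorems.LiouvilleMADEngineToGHL
import Summits.Parity.GeneralizedHardyLittlewood.Theorems.LiouvilleMADEngineToGHLIllusory
import Summits.Parity.GeneralizedHardyLittlewood.Theorems.LiouvilleShiftedTablesPairsHLStatus
import Summits.Parity.GeneralizedHardyLittlewood.Theorems.EngineToPairs.Negative.EngineToPairsShiftBoundary
import Summits.Parity.GeneralizedHardyLittlewood.Theorems.PairsToGHL.Negative.UnboundedSiegelZeros
import Literature.Barriers.Parity.SiegelZeroDichotomyProofs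

/-!
# Disproof of `EngineToGHL` (crux stmt-Parity-14995, route LiouvilleMAD) — findings of the
# standing disprover (cdisprove seat refuter-cdisprove-stmt-Parity-14995-0, cycle 1, 2026-08-16)

`EngineToGHL := (CosetDecorrelation → FanDecorrelation → DilatedChowla) ∧ (DilatedChowla →
TypeIILiouville) ∧ (TypeIILiouville → LambdaLiouvilleLevel) ∧ (LambdaLiouvilleLevel →
ElliottHalberstam → PairsHL) ∧ (PairsHL → GeneralizedHardyLittlewood)`, with `PairsHL` inlined
(`∀ h ≥ 1, ∑_{n ≤ N} Λ(n)Λ(n+h) − 𝔖({0,h})·N = o(N)`).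

## Findings (everything below is kernel-checked and sorry-free; "tree" = an accepted Theorems file)

0. VERDICT: NO KILL IS POSSIBLE SHORT OF THE TWIN PRIME CONJECTURE. Conjuncts 1–4 are tree
   theorems (`Theorems.EngineToGHL.glue`, p95950), so `EngineToGHL ↔ PairsToGHL ↔ (PairsHL → GHL)`
   with NO hypothesis (`engineToGHL_iff_pairsToGHL`, tree) and
   `¬EngineToGHL ↔ PairsHL ∧ ¬GHL` (`not_engineToGHL_iff`, tree). §0 below spells out the price:
   a disproof proves the Hardy–Littlewood prime-pair conjecture in counting form at every even
   shift (`primePairCount_of_not_engineToGHL`), hence the twin prime conjecture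
   (`twinPrimeConjecture_of_not_engineToGHL`), AND refutes Green–Tao's Conjecture 1.2. The typed
   conjecture has no junk instance (audit of the PairsToGHL seat, `Cruxes/PairsToGHL/Disproof.lean`
   finding 2, re-read and concurred: `t ≥ 1`, absolute error `εN^d`, `IsNondegenerateSystem`,
   `Λ ∘ Int.toNat`, `N ≥ N₀`).
1. LOAD-BEARING ANALYSIS (§1). Conjuncts 1–4 carry NO load (`engineToGHL_iff_conj5`: dropping or
   keeping them changes nothing, they are theorems). ALL load sits in conjunct 5, whose single
   hypothesis `PairsHL` is load-bearing in the only available sense: dropped, the crux is `GHL`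
   itself (`engineToGHLWithoutPairsHL_iff`), refuted in the illusory world (2). The hypothesis
   `ElliottHalberstam` of conjunct 4 cannot be shown load-bearing (conjunct 4 is a theorem WITH it;
   without it, `LambdaLiouvilleLevel → PairsHL` is an open EH-free Murty–Vatwani — not refutable,
   not provable here). The GUARD `1 ≤ h` threaded through conjuncts 4 → 5 IS load-bearing
   (`engineToGHL_unguarded_iff`: with `h = 0` admitted the pair statement is false — tree
   `EngineToPairs.Negative.pairsShape_false_at_zero`, `∑ Λ(n)² = N + o(N)` is absurd — so conjunct 5
   turns vacuous and the crux collapses to `¬(LambdaLiouvilleLevel ∧ ElliottHalberstam)`).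
2. ILLUSORY-WORLD KILL (tree, `LiouvilleMADEngineToGHLIllusory.lean` p96563, transported from the
   PairsToGHL seat's `PairsToGHL/Negative/UnboundedSiegelZeros.lean`): modulo the vendored
   Matomäki–Merikoski Theorem 1.3, `UnboundedSiegelZeros → PairsHL → ¬EngineToGHL`; under the other
   three hypotheses of `closes` the fourth is FALSE there; `EngineToGHL ∧ PairsHL` bounds Siegel-zero
   quality. NEW here (§2): the kill survives strengthening the hypothesis of conjunct 5 to the full
   prime `k`-tuples conjecture — `UnboundedSiegelZeros → ¬(HardyLittlewoodTuples → GHL)`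
   (`tuplesToGHL_false_of_unboundedSiegelZeros`) — so the obstruction in conjunct 5 is NOT the
   pairs-vs-tuples gap but the SHIFT-UNIFORMITY `|bᵢ| ≤ L·N` of the typed Green–Tao conjecture.
   In the GRH world the lever is void (`GRH → ¬UnboundedSiegelZeros`, tree), so this is the end of
   the conditional-refutation line.
3. NATURAL STRENGTHENINGS REFUTED UNCONDITIONALLY (§3, tree `EngineToPairs.Negative`, reused not
   redone): the pair statement including `h = 0` (`not_forall_shift`); the pair statement with `o(N)`
   uniform in ALL shifts `h ≥ 1` (`not_uniform_in_shift`, witness `h = (N!)²` — super-polynomial, so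
   it says nothing about Green–Tao's range `h ≤ L·N`). Consequences for the crux: §1 and
   `conj5_hyp_not_uniform`.
4. LINE `Sketch` (§4, payload line; lead prover-line-stmt-Parity-14995-c1-0, PICKED.md): one stub,
   `stub_pairsToGHL : PairsToGHL` = the existing shared item stmt-Parity-9389. JOINT SUFFICIENCY is
   exact and gap-free — the stub is EQUIVALENT to the crux (`stub_iff_crux`), so `EngineToGHL_of`
   smuggles nothing and the stub cannot be weakened; attacking the stub IS attacking the crux (0–3
   apply verbatim; the 9389 seat's Disproof.lean is the reference). Targets / stuck stubs: none
   in the payload.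
5. WHY IT RESISTS (for provers and planners). Granting `PairsHL`, conjunct 5 still contains (a)
   prime `k`-tuples for all `k ≥ 3`, (b) all slopes at `t = 2` incl. `(n, M − n)` for EVERY even
   `M ≤ LN` with no exceptional set, (c) shift-uniformity `h ≤ LN` (Landau–Siegel-complete by 2),
   (d) `d ≥ 2` (free: `GHL ↔ DimOne`, tree `generalizedHardyLittlewood_iff_dimOne`). No known
   argument derives any of (a)–(c) from fixed-shift pairs; (a) fails already for MODELS (pair
   statistics of a nonnegative weight do not determine its triple statistics — `decide`d toy of
   the 9389 seat, `toy_pairs_do_not_determine_triples`). RECOMMENDATION (concurring with both leads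
   and the 9389 seats): restate `EngineToGHL ↦ PairsToGHL` (END FORM of `closes`) or rewire conjunct 5
   to `DimOne` (stmt-Parity-0819); hold 14995 ≡ 9389 behind 0819; any restatement must keep the
   guard `1 ≤ h` / "no repeated shift" (finding 1).
   NEXT REGIMES for a re-armed seat: (i) a Lean barrier theorem `∃ w ≥ 0` with Hardy–Littlewood
   pair asymptotics at every shift but biased triples (Cramér–Granville weight with block
   perturbations; sizeable); (ii) a model separating fixed shifts from uniform shifts `h ≤ N`
   (growing-block sign patterns; cheap but only heuristic value); (iii) nothing further on the
   unconditional side — every unconditional `¬` here needs `PairsHL`.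

LANDINGS: `Theorems/EngineToGHL/Negative/EngineToGHLGuardsAndCost.lean` — p99892 ACCEPTED
(commit 31eab7cd0eab, `--supports stmt-Parity-14995`; namespace
`Theorems.EngineToGHL.Negative`: `twinPrimeConjecture_of_not_engineToGHL`,
`primePairCount_of_not_engineToGHL`, `not_generalizedHardyLittlewood_of_not_engineToGHL`,
`conj5_unguarded_vacuous`, `conj4_unguarded_iff`, `engineToGHL_unguarded_iff`,
`tuplesToGHL_false_of_unboundedSiegelZeros`, `engineToGHL_false_of_unboundedSiegelZeros_of_tuples`,
`siegelZeros_bounded_of_tuplesToGHL` — §0–§2 of this file in importable form; ideators and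
planners may import it). This workfile keeps its own inline derivations (identical statements up
to naming) so that it does not depend on that module. [folklore]
-/

namespace Summit.Parity.GeneralizedHardyLittlewood.Cruxes.EngineToGHL.Disproof

open Finset Filter Asymptotics ArithmeticFunction
open Literature.NumberTheory.Sieve Literature.Barriers.Parity
open Summit.Parity.GeneralizedHardyLittlewood.Theses
open Summit.Parity.GeneralizedHardyLittlewood.Theses.LiouvilleMAD
open Summit.Parity.GeneralizedHardyLittlewood.Theorems
open Summit.Parity.GeneralizedHardyLittlewood.Theorems.EngineToGHL

noncomputable section

/-! ## §0 Truth-functional structure: what a refutation of the crux would be -/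

/-- The crux IS the shared residual, with no hypothesis (tree, p95950). [folklore] -/
theorem crux_iff_residual : EngineToGHL ↔ (LiouvilleShiftedTables.PairsHL → _root_.GeneralizedHardyLittlewood) :=
  engineToGHL_iff_pairsHL_imp_generalizedHardyLittlewood

/-- `¬EngineToGHL ↔ PairsHL ∧ ¬GHL` (tree): the ONLY shape of an unconditional kill. [folklore] -/
theorem not_crux_iff : ¬ EngineToGHL ↔ (LiouvilleShiftedTables.PairsHL ∧ ¬ _root_.GeneralizedHardyLittlewood) :=
  not_engineToGHL_iff

/-- THE PRICE OF A DISPROOF, I: a refutation of the crux proves the twin prime conjecture.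
[folklore] -/
theorem twinPrimeConjecture_of_not_engineToGHL (h : ¬ EngineToGHL) : TwinPrimeConjecture :=
  PairsHL.twinPrimeConjecture_of_pairsHL (not_engineToGHL_iff.mp h).1

/-- THE PRICE OF A DISPROOF, II: … indeed the Hardy–Littlewood prime-pair conjecture in counting
form `π_{{0,k}}(x) ∼ 𝔖({0,k}) x/log² x` at every even shift `k ≥ 2`. [folklore] -/
theorem primePairCount_of_not_engineToGHL (h : ¬ EngineToGHL) {k : ℕ} (hk : Even k) (hk1 : 1 ≤ k) :
    (fun x : ℕ ↦ (primeTupleCount ({0, (k : ℤ)} : Finset ℤ) x : ℝ)) ~[atTop]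
      fun x : ℕ ↦ singularSeries ({0, (k : ℤ)} : Finset ℤ) * x / Real.log x ^ 2 :=
  (PairsHL.pairsHL_iff_count_even.mp (not_engineToGHL_iff.mp h).1) k hk hk1

/-- THE PRICE OF A DISPROOF, III: … and refutes Green–Tao's Conjecture 1.2 as typed. [folklore] -/
theorem not_ghl_of_not_engineToGHL (h : ¬ EngineToGHL) : ¬ _root_.GeneralizedHardyLittlewood :=
  (not_engineToGHL_iff.mp h).2

/-- TRUTH TABLE (one conjunction, so that no component poses as a proof of the item): the crux is
TRUE in the GHL world, (vacuously) TRUE if binary Hardy–Littlewood fails at some fixed shift, and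
under the route's own target `PairsHL` it IS the summit conjunct. [folklore] -/
theorem crux_truthTable :
    (_root_.GeneralizedHardyLittlewood → EngineToGHL) ∧
    (¬ LiouvilleShiftedTables.PairsHL → EngineToGHL) ∧
    (LiouvilleShiftedTables.PairsHL → (EngineToGHL ↔ _root_.GeneralizedHardyLittlewood)) :=
  ⟨engineToGHL_of_generalizedHardyLittlewood, engineToGHL_of_not_pairsHL,
    engineToGHL_iff_generalizedHardyLittlewood_of_pairsHL⟩

/-! ## §1 Load-bearing analysis, conjunct by conjunct -/

/-- Conjuncts 1–4 DROPPED (they are theorems: `glue`): what is left is conjunct 5 alone. [folklore] -/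
def EngineToGHLConj5 : Prop :=
  (∀ h : ℕ, 1 ≤ h → (fun N : ℕ => ∑ n ∈ Finset.Icc 1 N, Λ n * Λ (n + h) -
      singularSeries ({0, (h : ℤ)} : Finset ℤ) * N) =o[atTop] fun N : ℕ => (N : ℝ)) →
    _root_.GeneralizedHardyLittlewood

/-- "Conjuncts 1–4 carry no load": the crux is equivalent to its fifth conjunct. [folklore] -/
theorem engineToGHL_iff_conj5 : EngineToGHL ↔ EngineToGHLConj5 :=
  engineToGHL_iff_pairsToGHL

/-- Conjunct 5's hypothesis `PairsHL` DROPPED: the crux becomes `glue ∧ GHL`. [folklore] -/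
def EngineToGHLWithoutPairsHL : Prop :=
  (CosetDecorrelation → FanDecorrelation → DilatedChowla) ∧ (DilatedChowla → TypeIILiouville) ∧
    (TypeIILiouville → LambdaLiouvilleLevel) ∧
    (LambdaLiouvilleLevel → ElliottHalberstam → LiouvilleShiftedTables.PairsHL) ∧
    _root_.GeneralizedHardyLittlewood

/-- … which is the summit conjunct itself. [folklore] -/
theorem engineToGHLWithoutPairsHL_iff : EngineToGHLWithoutPairsHL ↔ _root_.GeneralizedHardyLittlewood :=
  ⟨fun h => h.2.2.2.2, fun h => ⟨glue.1, glue.2.1, glue.2.2.1, glue.2.2.2, h⟩⟩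

/-- "Any proof must USE `PairsHL` — and must repel Siegel zeros": with `PairsHL` dropped the crux is
FALSE in the illusory world (modulo Matomäki–Merikoski; tree
`PairsToGHL.Negative.not_generalizedHardyLittlewood_of_unboundedSiegelZeros`).
[cite: MatomakiMerikoski2023, Theorem 1.3] -/
theorem engineToGHL_false_without_pairsHL_of_unboundedSiegelZeros
    (hMM : MatomakiMerikoski2023_pairCorrelation) (hU : UnboundedSiegelZeros) :
    ¬ EngineToGHLWithoutPairsHL := fun h =>
  PairsToGHL.Negative.not_generalizedHardyLittlewood_of_unboundedSiegelZeros hMM hU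
    (engineToGHLWithoutPairsHL_iff.mp h)

/-- Conjunct 4's hypothesis `ElliottHalberstam` DROPPED: an EH-free Murty–Vatwani,
`LambdaLiouvilleLevel → PairsHL`. OPEN in both directions — not refutable here (that needs
`LambdaLiouvilleLevel ∧ ¬PairsHL`), not provable by the route (the prime side of the split needs
level `x^{1−ε}`); recorded so that nobody mistakes EH for decoration: it is used, but cannot be SHOWN
load-bearing. [folklore] -/
def Conj4WithoutEH : Prop :=
  LambdaLiouvilleLevel → LiouvilleShiftedTables.PairsHL

/-- The only cheap facts about `Conj4WithoutEH`: it follows from `PairsHL` outright and from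
`¬LambdaLiouvilleLevel` vacuously (truth table; neither disjunct is known). [folklore] -/
theorem conj4WithoutEH_truthTable :
    (LiouvilleShiftedTables.PairsHL → Conj4WithoutEH) ∧ (¬ LambdaLiouvilleLevel → Conj4WithoutEH) :=
  ⟨fun h _ => h, fun h hL => absurd hL h⟩

/-- THE GUARD `1 ≤ h` DROPPED in conjuncts 4 and 5 (conjuncts 1–3 verbatim). [folklore] -/
def EngineToGHLUnguarded : Prop :=
  (CosetDecorrelation → FanDecorrelation → DilatedChowla) ∧ (DilatedChowla → TypeIILiouville) ∧
    (TypeIILiouville → LambdaLiouvilleLevel) ∧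
    (LambdaLiouvilleLevel → ElliottHalberstam → ∀ h : ℕ,
      (fun N : ℕ => ∑ n ∈ Finset.Icc 1 N, Λ n * Λ (n + h) -
        singularSeries ({0, (h : ℤ)} : Finset ℤ) * N) =o[atTop] fun N : ℕ => (N : ℝ)) ∧
    ((∀ h : ℕ, (fun N : ℕ => ∑ n ∈ Finset.Icc 1 N, Λ n * Λ (n + h) -
        singularSeries ({0, (h : ℤ)} : Finset ℤ) * N) =o[atTop] fun N : ℕ => (N : ℝ)) →
      _root_.GeneralizedHardyLittlewood)

/-- **The guard is load-bearing**: unguarded, conjunct 5 is vacuous (its hypothesis is false at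
`h = 0`, tree `EngineToPairs.Negative.not_forall_shift`) and conjunct 4 says that the engine output
contradicts EH, so the unguarded crux is literally `¬(LambdaLiouvilleLevel ∧ ElliottHalberstam)` —
an ANTI-route statement. Any restatement of the crux must keep "`1 ≤ h`" / "no repeated shift".
[folklore] -/
theorem engineToGHL_unguarded_iff :
    EngineToGHLUnguarded ↔ ¬ (LambdaLiouvilleLevel ∧ ElliottHalberstam) :=
  ⟨fun H hLE => EngineToPairs.Negative.not_forall_shift (H.2.2.2.1 hLE.1 hLE.2),
    fun H => ⟨glue.1, glue.2.1, glue.2.2.1, fun hL hE => (H ⟨hL, hE⟩).elim,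
      fun hP => (EngineToPairs.Negative.not_forall_shift hP).elim⟩⟩

/-! ## §2 The illusory world (tree) — and why prime `k`-tuples would not rescue conjunct 5 -/

/-- Tree (p96563): Siegel zeros of unbounded quality and `PairsHL` refute the crux, modulo
Matomäki–Merikoski. [cite: MatomakiMerikoski2023, Theorem 1.3] -/
theorem crux_false_of_unboundedSiegelZeros (hMM : MatomakiMerikoski2023_pairCorrelation)
    (hU : UnboundedSiegelZeros) (hP : LiouvilleShiftedTables.PairsHL) : ¬ EngineToGHL :=
  engineToGHL_false_of_unboundedSiegelZeros hMM hU hP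

/-- NEW: **even the full prime `k`-tuples conjecture at fixed tuples does not imply the typed
Green–Tao conjecture in the illusory world** — `HardyLittlewoodTuples` gives `PairsHL` (tree
`PairsHL.pairsHL_of_hardyLittlewoodTuples`) while GHL fails at the shift-uniform slice
`(n, n + 2q)`, `N = q¹⁰`. So the obstruction inside conjunct 5 is shift-uniformity, not the
pairs-versus-tuples gap. [cite: MatomakiMerikoski2023, Theorem 1.3] -/
theorem tuplesToGHL_false_of_unboundedSiegelZeros (hMM : MatomakiMerikoski2023_pairCorrelation)
    (hU : UnboundedSiegelZeros) (hT : HardyLittlewoodTuples) :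
    ¬ (HardyLittlewoodTuples → _root_.GeneralizedHardyLittlewood) := fun H =>
  PairsToGHL.Negative.not_generalizedHardyLittlewood_of_unboundedSiegelZeros hMM hU (H hT)

/-- NEW: in the illusory world the prime `k`-tuples conjecture REFUTES the crux.
[cite: MatomakiMerikoski2023, Theorem 1.3] -/
theorem crux_false_of_unboundedSiegelZeros_of_tuples (hMM : MatomakiMerikoski2023_pairCorrelation)
    (hU : UnboundedSiegelZeros) (hT : HardyLittlewoodTuples) : ¬ EngineToGHL := fun hX =>
  PairsToGHL.Negative.not_generalizedHardyLittlewood_of_unboundedSiegelZeros hMM hU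
    (pairsToGHL_of_engineToGHL hX (PairsHL.pairsHL_of_hardyLittlewoodTuples hT))

/-- The lever is void under GRH (tree): no Siegel-zero refutation of the crux can be made
unconditional without refuting GRH. [folklore] -/
theorem lever_void_under_grh (h : Literature.NumberTheory.LFunctions.GeneralizedRiemannHypothesis) :
    ¬ UnboundedSiegelZeros :=
  not_unboundedSiegelZeros_of_generalizedRiemannHypothesis h

/-! ## §3 Natural strengthenings of conjunct 5's hypothesis, refuted unconditionally (tree, reused) -/

/-- The pair statement CANNOT include `h = 0` (tree `EngineToPairs.Negative.not_forall_shift`):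
`∑_{n ≤ N} Λ(n)² = N + o(N)` is absurd (it is `∼ N log N`). [folklore] -/
theorem conj5_hyp_unguarded_false :
    ¬ ∀ h : ℕ, (fun N : ℕ => ∑ n ∈ Finset.Icc 1 N, Λ n * Λ (n + h) -
        singularSeries ({0, (h : ℤ)} : Finset ℤ) * N) =o[atTop] fun N : ℕ => (N : ℝ) :=
  EngineToPairs.Negative.not_forall_shift

/-- The pair statement CANNOT be uniform over all shifts `h ≥ 1` (tree
`EngineToPairs.Negative.not_uniform_in_shift`, witness `h = (N!)²`, where every term vanishes while
`𝔖({0,h}) ≥ 1`). The witness is super-polynomial in `N`, hence silent about Green–Tao's range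
`h ≤ L·N`, where uniformity is exactly the Siegel-hard content of §2. [folklore] -/
theorem conj5_hyp_not_uniform :
    ¬ ∀ ε : ℝ, 0 < ε → ∀ᶠ N : ℕ in atTop, ∀ h : ℕ, 1 ≤ h →
      |∑ n ∈ Icc 1 N, Λ n * Λ (n + h) - singularSeries ({0, (h : ℤ)} : Finset ℤ) * N| ≤ ε * N :=
  EngineToPairs.Negative.not_uniform_in_shift

/-! ## §4 Line `Sketch` (payload line; one stub `stub_pairsToGHL : PairsToGHL` = item stmt-Parity-9389) -/

/-- JOINT SUFFICIENCY IS EXACT: the line's single stub is EQUIVALENT to the crux (tree), so the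
composition `EngineToGHL_of` smuggles no gap and the stub admits no weakening — any reshaped stub
set `S₁ → … → EngineToGHL` contains a stub at least as strong as `PairsHL → GHL`. [folklore] -/
theorem stub_iff_crux : LiouvilleShiftedTables.PairsToGHL ↔ EngineToGHL :=
  engineToGHL_iff_pairsToGHL.symm

/-- The stub is exactly as irrefutable as the crux: `¬stub ↔ PairsHL ∧ ¬GHL`. [folklore] -/
theorem not_stub_iff :
    ¬ LiouvilleShiftedTables.PairsToGHL ↔ (LiouvilleShiftedTables.PairsHL ∧ ¬ _root_.GeneralizedHardyLittlewood) := by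
  rw [stub_iff_crux]; exact not_engineToGHL_iff

/-- The alternative single stub `DimOne` (stmt-Parity-0819) is STRONGER than needed by exactly the
hypothesis `PairsHL`: `EngineToGHL ↔ (PairsHL → DimOne)` (tree). [folklore] -/
theorem crux_iff_pairsHL_imp_dimOne : EngineToGHL ↔ (LiouvilleShiftedTables.PairsHL → DicksonFibration.DimOne) :=
  engineToGHL_iff_pairsHL_imp_dimOne

end

end Summit.Parity.GeneralizedHardyLittlewood.Cruxes.EngineToGHL.Disproof
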